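import Summits.NavierStokesRegularity.NavierStokesRegularity.Theses.AxisymmetricExtremality
import Summits.NavierStokesRegularity.NavierStokesRegularity.Theorems.AxisymmetricExtremalityPFoldToAxisymmetricMotionTools
import Literature.Analysis.FluidPDE.CriticalSpaces

/-!
# Route AxisymmetricExtremality — crux `MinimalDatumPFold` (stmt-NavierStokesRegularity-15452), stub `stub_symmetryDefectInLimit`

Registered stub of the line `symmetric-gap` (`Cruxes/MinimalDatumPFold/Lines/symmetric_gap.lean`, lead c1, cycle 2).
Target tree file: `Summits/NavierStokesRegularity/NavierStokesRegularity/Theorems/AxisymmetricExtremalityMinimalDatumPFoldSymmetryDefectInLimit.lean`.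

**Discrete rotational symmetry survives modulated `L³`-limits up to a horizontal shift of the
axis.** Write `R = R_θ = rotZ θ` (`θ = 2π/p`) for the rotation about the `x₂`-axis. If
`U j ∈ L³` is a.e. `R`-equivariant, `lam j > 0`, `x₀ j ∈ ℝ³`, and the modulated fields
`v j x := lam j • U j (lam j • x - x₀ j)` converge in `L³` to `u ∈ L³`, `u` not a.e. zero, then
`u (R x - x₁) = R (u x)` a.e. for some horizontal `x₁` (`x₁ 2 = 0`).

Proof (pure real analysis, [folklore]).
* `R` is linear, so each `v j` is equivariant up to the HORIZONTAL shift
  `c j := (lam j)⁻¹ • (x₀ j - R (x₀ j))`: `v j (R x + c j) = R (v j x)` a.e.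
  (`symmetryDefect_rescale_ae`; the affine change of variables is quasi-measure-preserving).
* Key estimate (`symmetryDefect_eLpNorm_le`): `‖u (R · + c j) − R ∘ u‖₃ ≤ 2 ‖v j − u‖₃ → 0`
  (motions preserve Lebesgue measure, `R` preserves norms of values).
* If `‖c j‖ → ∞` the mass escapes (`symmetryDefect_ae_eq_zero_of_escape`, the landed escape
  lemma `eLpNorm_eq_zero_of_tendsto_eLpNorm_comp_motion_sub` applied to the scalar field
  `‖u‖ • e₂`, for which the rotation of values is invisible): `u = 0` a.e., excluded.
* Otherwise a subsequence of `(c j)` converges to some horizontal `c∞` (Bolzano–Weierstrass); by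
  the strong continuity of translations on `L³` (`tendsto_eLpNorm_comp_motion_sub`),
  `u (R x + c∞) = R (u x)` a.e., and `x₁ := -c∞` does it (`symmetryDefect_limit`).
-/

set_option linter.dupNamespace false

noncomputable section

open MeasureTheory Set Function Filter Topology
open scoped ENNReal NNReal

namespace Summit.NavierStokesRegularity.NavierStokesRegularity.Theorems

open Literature.Analysis.FluidPDE
open Summit.NavierStokesRegularity.NavierStokesRegularity.Theorems.PFoldToAxisymmetric.AxisPinning

/-- **Key estimate.** If `v` is `R_θ`-equivariant up to the shift `c`, `v (R_θ x + c) = R_θ (v x)`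
a.e., then for any `u`: `‖u (R_θ · + c) − R_θ ∘ u‖_{L³} ≤ ‖v − u‖_{L³} + ‖v − u‖_{L³}`
(the motion `x ↦ R_θ x + c` preserves Lebesgue measure and `R_θ` preserves norms). [folklore] -/
theorem symmetryDefect_eLpNorm_le {θ : ℝ}
    {u v : EuclideanSpace ℝ (Fin 3) → EuclideanSpace ℝ (Fin 3)}
    (hu : AEStronglyMeasurable u volume) (hv : AEStronglyMeasurable v volume)
    {c : EuclideanSpace ℝ (Fin 3)}
    (hvc : ∀ᵐ x ∂(volume : Measure (EuclideanSpace ℝ (Fin 3))), v (rotZ θ x + c) = rotZ θ (v x)) :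
    eLpNorm (fun x => u (rotZ θ x + c) - rotZ θ (u x)) 3 volume ≤
      eLpNorm (v - u) 3 volume + eLpNorm (v - u) 3 volume := by
  have hA : MeasurePreserving (fun x : EuclideanSpace ℝ (Fin 3) => rotZ θ x + c) volume volume :=
    measurePreserving_motion θ c
  have hsub : ∀ a b : EuclideanSpace ℝ (Fin 3), rotZ θ (a - b) = rotZ θ a - rotZ θ b := fun a b => by
    simpa only [rotZLIE_apply] using (rotZLIE θ).map_sub a b
  -- split `u ∘ A − R ∘ u = (u − v) ∘ A + R ∘ (v − u)` a.e.
  have hsplit : (fun x => u (rotZ θ x + c) - rotZ θ (u x)) =ᵐ[volume]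
      ((u - v) ∘ fun x => rotZ θ x + c) + fun x => rotZ θ ((v - u) x) := by
    filter_upwards [hvc] with x hx
    simp only [Pi.add_apply, comp_apply, Pi.sub_apply, hsub, ← hx]
    abel
  have h1 : AEStronglyMeasurable ((u - v) ∘ fun x => rotZ θ x + c) volume :=
    (hu.sub hv).comp_measurePreserving hA
  have h2 : AEStronglyMeasurable (fun x => rotZ θ ((v - u) x)) volume :=
    (rotZLIE θ).continuous.comp_aestronglyMeasurable (hv.sub hu)
  rw [eLpNorm_congr_ae hsplit]
  refine (eLpNorm_add_le h1 h2 (by norm_num)).trans (le_of_eq ?_)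
  congr 1
  · rw [eLpNorm_comp_measurePreserving (hu.sub hv) hA, eLpNorm_sub_comm]
  · exact eLpNorm_congr_norm_ae (Eventually.of_forall fun x => norm_rotZ θ _)

/-- **Modulated equivariant fields are equivariant up to a horizontal shift.** If
`U (R_θ x) = R_θ (U x)` a.e. and `lam ≠ 0`, then the modulated field
`v x := lam • U (lam • x − x₀)` (`rescaleData lam (U (· − x₀))`) satisfies
`v (R_θ x + c) = R_θ (v x)` a.e. with `c := lam⁻¹ • (x₀ − R_θ x₀)`: by linearity of `R_θ`,
`lam • (R_θ x + c) − x₀ = R_θ (lam • x − x₀)`, and the affine map `x ↦ lam • x − x₀` is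
quasi-measure-preserving. [folklore] -/
theorem symmetryDefect_rescale_ae {θ : ℝ} {U : EuclideanSpace ℝ (Fin 3) → EuclideanSpace ℝ (Fin 3)}
    (hU : ∀ᵐ x ∂(volume : Measure (EuclideanSpace ℝ (Fin 3))), U (rotZ θ x) = rotZ θ (U x))
    {lam : ℝ} (hlam : lam ≠ 0) (x₀ : EuclideanSpace ℝ (Fin 3)) :
    ∀ᵐ x ∂(volume : Measure (EuclideanSpace ℝ (Fin 3))),
      rescaleData lam (fun y => U (y - x₀)) (rotZ θ x + lam⁻¹ • (x₀ - rotZ θ x₀)) =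
        rotZ θ (rescaleData lam (fun y => U (y - x₀)) x) := by
  have hS : Measure.QuasiMeasurePreserving (fun x : EuclideanSpace ℝ (Fin 3) => lam • x - x₀) volume volume :=
    (measurePreserving_sub_right volume x₀).quasiMeasurePreserving.comp
      (Measure.quasiMeasurePreserving_smul volume hlam)
  have hsub : ∀ a b : EuclideanSpace ℝ (Fin 3), rotZ θ (a - b) = rotZ θ a - rotZ θ b := fun a b => by
    simpa only [rotZLIE_apply] using (rotZLIE θ).map_sub a b
  have hsmul : ∀ (r : ℝ) (a : EuclideanSpace ℝ (Fin 3)), rotZ θ (r • a) = r • rotZ θ a := fun r a => by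
    simpa only [rotZLIE_apply] using (rotZLIE θ).map_smul r a
  have hU' : ∀ᵐ x ∂(volume : Measure (EuclideanSpace ℝ (Fin 3))),
      U (rotZ θ (lam • x - x₀)) = rotZ θ (U (lam • x - x₀)) := hS.ae hU
  filter_upwards [hU'] with x hx
  have h1 : lam • (rotZ θ x + lam⁻¹ • (x₀ - rotZ θ x₀)) - x₀ = rotZ θ (lam • x - x₀) := by
    rw [smul_add, smul_inv_smul₀ hlam, hsub, hsmul]
    abel
  simp only [rescaleData_apply]
  rw [h1, hx, hsmul]

/-- **Escape of the axis kills the limit.** If `u ∈ L³`, `‖c j‖ → ∞` and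
`‖u (R_θ · + c j) − R_θ ∘ u‖_{L³} → 0`, then `u = 0` a.e.: the scalar field `F := ‖u‖ • e₂ ∈ L³`
satisfies `‖F (R_θ x + c j) − F x‖ ≤ ‖u (R_θ x + c j) − R_θ (u x)‖` (`‖R_θ w‖ = ‖w‖`), so the
landed escape lemma `eLpNorm_eq_zero_of_tendsto_eLpNorm_comp_motion_sub` gives `F = 0` in `L³`.
[folklore] -/
theorem symmetryDefect_ae_eq_zero_of_escape {θ : ℝ}
    {u : EuclideanSpace ℝ (Fin 3) → EuclideanSpace ℝ (Fin 3)} (hu : MemLp u 3 volume)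
    {c : ℕ → EuclideanSpace ℝ (Fin 3)} (hc : Tendsto (fun j => ‖c j‖) atTop atTop)
    (h : Tendsto (fun j => eLpNorm (fun x => u (rotZ θ x + c j) - rotZ θ (u x)) 3 volume)
      atTop (𝓝 0)) :
    u =ᵐ[volume] 0 := by
  set e : EuclideanSpace ℝ (Fin 3) := EuclideanSpace.single (2 : Fin 3) (1 : ℝ) with he
  have he1 : ‖e‖ = 1 := by simp [he]
  set F : EuclideanSpace ℝ (Fin 3) → EuclideanSpace ℝ (Fin 3) := fun x => ‖u x‖ • e with hF
  have hFn : ∀ x, ‖F x‖ = ‖u x‖ := fun x => by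
    simp only [hF, norm_smul, norm_norm, he1, mul_one]
  have hFmeas : AEStronglyMeasurable F volume := hu.1.norm.smul aestronglyMeasurable_const
  have hFp : MemLp F 3 volume := MemLp.of_le hu hFmeas (Eventually.of_forall fun x => (hFn x).le)
  have hF0 : eLpNorm F 3 volume = 0 := by
    refine eLpNorm_eq_zero_of_tendsto_eLpNorm_comp_motion_sub hFp (θ := fun _ => θ) (c := c) hc ?_
    refine tendsto_of_tendsto_of_tendsto_of_le_of_le tendsto_const_nhds h (fun _ => zero_le)
      fun j => eLpNorm_mono fun x => ?_
    simp only [hF]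
    rw [← sub_smul, norm_smul, he1, mul_one, ← norm_rotZ θ (u x), Real.norm_eq_abs]
    exact abs_norm_sub_norm_le _ _
  have hFae := (eLpNorm_eq_zero_iff hFmeas three_ne_zero).1 hF0
  filter_upwards [hFae] with x hx
  have h1 : ‖F x‖ = 0 := by rw [hx]; exact norm_zero
  rw [hFn] at h1
  simpa using h1

/-- **Symmetry defect in the limit, abstract form.** Let `v j → u` in `L³(ℝ³; ℝ³)` with `u ∈ L³`
not a.e. zero, and suppose each `v j` is `R_θ`-equivariant up to a horizontal shift:
`v j (R_θ x + c j) = R_θ (v j x)` a.e., `(c j) 2 = 0`. Then `u (R_θ x − x₁) = R_θ (u x)` a.e.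
for some horizontal `x₁`. Proof: `‖u (R_θ · + c j) − R_θ ∘ u‖₃ ≤ 2‖v j − u‖₃ → 0`
(`symmetryDefect_eLpNorm_le`); if `‖c j‖ → ∞` then `u = 0` a.e.
(`symmetryDefect_ae_eq_zero_of_escape`), excluded; otherwise a subsequence `c (ψ n) → c∞`,
horizontal, and strong continuity of translations in `L³` gives `u (R_θ x + c∞) = R_θ (u x)` a.e.;
take `x₁ := −c∞`. [folklore] -/
theorem symmetryDefect_limit {θ : ℝ}
    {v : ℕ → EuclideanSpace ℝ (Fin 3) → EuclideanSpace ℝ (Fin 3)} {c : ℕ → EuclideanSpace ℝ (Fin 3)}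
    {u : EuclideanSpace ℝ (Fin 3) → EuclideanSpace ℝ (Fin 3)}
    (hv : ∀ j, AEStronglyMeasurable (v j) volume)
    (hvc : ∀ j, ∀ᵐ x ∂(volume : Measure (EuclideanSpace ℝ (Fin 3))), v j (rotZ θ x + c j) = rotZ θ (v j x))
    (hc2 : ∀ j, c j 2 = 0) (hu : MemLp u 3 volume) (hne : ¬ u =ᵐ[volume] 0)
    (hconv : Tendsto (fun j => eLpNorm (v j - u) 3 volume) atTop (𝓝 0)) :
    ∃ x₁ : EuclideanSpace ℝ (Fin 3), x₁ 2 = 0 ∧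
      ∀ᵐ x ∂(volume : Measure (EuclideanSpace ℝ (Fin 3))), u (rotZ θ x - x₁) = rotZ θ (u x) := by
  -- the key estimate along the sequence
  have hkey : Tendsto (fun j => eLpNorm (fun x => u (rotZ θ x + c j) - rotZ θ (u x)) 3 volume)
      atTop (𝓝 0) := by
    have h2 : Tendsto (fun j => eLpNorm (v j - u) 3 volume + eLpNorm (v j - u) 3 volume)
        atTop (𝓝 0) := by
      simpa using hconv.add hconv
    exact tendsto_of_tendsto_of_tendsto_of_le_of_le tendsto_const_nhds h2 (fun _ => zero_le)
      fun j => symmetryDefect_eLpNorm_le hu.1 (hv j) (hvc j)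
  by_cases hT : Tendsto (fun j => ‖c j‖) atTop atTop
  · exact absurd (symmetryDefect_ae_eq_zero_of_escape hu hT hkey) hne
  -- a bounded subsequence, then a convergent one
  rw [tendsto_atTop_atTop] at hT
  push Not at hT
  obtain ⟨b, hb⟩ := hT
  have hfreq : ∃ᶠ j in atTop, ‖c j‖ < b := frequently_atTop.2 fun i => hb i
  obtain ⟨φ, hφ, hφb⟩ := extraction_of_frequently_atTop hfreq
  obtain ⟨c₀, -, ψ, hψ, hlim⟩ := tendsto_subseq_of_bounded (Metric.isBounded_closedBall
    (x := (0 : EuclideanSpace ℝ (Fin 3))) (r := b)) (x := c ∘ φ)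
    (fun n => mem_closedBall_zero_iff.2 (hφb n).le)
  -- the limit shift is horizontal
  have hc₀ : c₀ 2 = 0 := by
    have hcont : Continuous fun x : EuclideanSpace ℝ (Fin 3) => x 2 := by fun_prop
    have h1 : Tendsto (fun n => ((c ∘ φ) ∘ ψ) n 2) atTop (𝓝 (c₀ 2)) := (hcont.tendsto c₀).comp hlim
    have h2 : (fun n => ((c ∘ φ) ∘ ψ) n 2) = fun _ => (0 : ℝ) := funext fun n => hc2 _
    rw [h2] at h1
    exact tendsto_nhds_unique h1 tendsto_const_nhds
  -- pass to the limit in the key estimate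
  have hcontL := tendsto_eLpNorm_comp_motion_sub hu (θ := fun _ => θ) (θ₀ := θ)
    (c := (c ∘ φ) ∘ ψ) (c₀ := c₀) tendsto_const_nhds hlim
  have hkeyL := hkey.comp ((hφ.comp hψ).tendsto_atTop)
  have hmeas : ∀ a : EuclideanSpace ℝ (Fin 3), AEStronglyMeasurable (fun x => u (rotZ θ x + a)) volume :=
    fun a => hu.1.comp_measurePreserving (measurePreserving_motion θ a)
  have hRu : AEStronglyMeasurable (fun x => rotZ θ (u x)) volume :=
    (rotZLIE θ).continuous.comp_aestronglyMeasurable hu.1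
  have hle : ∀ n, eLpNorm (fun x => u (rotZ θ x + c₀) - rotZ θ (u x)) 3 volume ≤
      eLpNorm (fun x => u (rotZ θ x + ((c ∘ φ) ∘ ψ) n) - rotZ θ (u x)) 3 volume +
        eLpNorm (fun x => u (rotZ θ x + ((c ∘ φ) ∘ ψ) n) - u (rotZ θ x + c₀)) 3 volume := fun n => by
    have hsplit : (fun x => u (rotZ θ x + c₀) - rotZ θ (u x)) =
        (fun x => u (rotZ θ x + ((c ∘ φ) ∘ ψ) n) - rotZ θ (u x)) -
          fun x => u (rotZ θ x + ((c ∘ φ) ∘ ψ) n) - u (rotZ θ x + c₀) := by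
      funext x
      simp only [Pi.sub_apply]
      abel
    rw [hsplit]
    exact eLpNorm_sub_le ((hmeas _).sub hRu) ((hmeas _).sub (hmeas _)) (by norm_num)
  have hsum := hkeyL.add hcontL
  rw [add_zero] at hsum
  have h0 : eLpNorm (fun x => u (rotZ θ x + c₀) - rotZ θ (u x)) 3 volume = 0 :=
    le_antisymm (ge_of_tendsto' hsum hle) zero_le
  refine ⟨-c₀, by simp [hc₀], ?_⟩
  have hae := (eLpNorm_eq_zero_iff ((hmeas c₀).sub hRu) three_ne_zero).1 h0
  filter_upwards [hae] with x hx
  rw [sub_neg_eq_add]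
  exact sub_eq_zero.1 hx

/-- **Discrete rotational symmetry passes to modulated `L³`-limits up to a horizontal shift of the
axis** (crux `MinimalDatumPFold`, line `symmetric-gap`, stub `stub_symmetryDefectInLimit`). Let
`U j ∈ L³` be a.e. `R`-equivariant (`R = R_{2π/p}` about the `x₂`-axis, written out), `lam j > 0`,
`x₀ j ∈ ℝ³`, and suppose the modulated fields `v_j := lam j • U j (lam j • x - x₀ j)` converge in
`L³` to `u ∈ L³`, `u` not a.e. zero. Then `u (R x - x₁) = R (u x)` a.e. for some HORIZONTAL `x₁`
(`x₁ 2 = 0`). Proof: the written-out rotation is `Literature.Analysis.FluidPDE.rotZ (2π/p)`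
definitionally; `R` is linear, so `v_j (R x + c_j) = R (v_j x)` a.e. with the horizontal shifts
`c_j = (lam j)⁻¹ • (x₀ j - R (x₀ j))` (`symmetryDefect_rescale_ae`), and `symmetryDefect_limit`
(escape of the axis would force `u = 0`; otherwise a subsequence of the shifts converges and the
strong continuity of translations on `L³` passes the equivariance to the limit) concludes.
[folklore] -/
theorem stub_symmetryDefectInLimit :
    ∀ (p : ℕ) (U : ℕ → EuclideanSpace ℝ (Fin 3) → EuclideanSpace ℝ (Fin 3)) (lam : ℕ → ℝ) (x₀ : ℕ → EuclideanSpace ℝ (Fin 3)) (u : EuclideanSpace ℝ (Fin 3) → EuclideanSpace ℝ (Fin 3)), (∀ j, MeasureTheory.MemLp (U j) 3 (MeasureTheory.volume : MeasureTheory.Measure (EuclideanSpace ℝ (Fin 3)))) → (∀ j, ∀ᵐ x ∂(MeasureTheory.volume : MeasureTheory.Measure (EuclideanSpace ℝ (Fin 3))), U j (WithLp.toLp 2 ![Real.cos (2 * Real.pi / p) * x 0 - Real.sin (2 * Real.pi / p) * x 1, Real.sin (2 * Real.pi / p) * x 0 + Real.cos (2 * Real.pi / p) * x 1, x 2]) =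 WithLp.toLp 2 ![Real.cos (2 * Real.pi / p) * U j x 0 - Real.sin (2 * Real.pi / p) * U j x 1, Real.sin (2 * Real.pi / p) * U j x 0 + Real.cos (2 * Real.pi / p) * U j x 1, U j x 2]) → (∀ j, 0 < lam j) → MeasureTheory.MemLp u 3 (MeasureTheory.volume : MeasureTheory.Measure (EuclideanSpace ℝ (Fin 3))) → ¬ (u =ᵐ[(MeasureTheory.volume : MeasureTheory.Measure (EuclideanSpace ℝ (Fin 3)))] (0 : EuclideanSpace ℝ (Fin 3) → EuclideanSpace ℝ (Fin 3))) → Filter.Tendsto (fun j => MeasureTheory.eLpNorm (Literature.Analysis.FluidPDE.rescaleData (lam j) (fun x => U j (x - x₀ j)) - u) 3 (MeasureTheory.volume : MeasureTheory.Measure (EuclideanSpace ℝ (Fin 3)))) Filter.atTop (nhds 0) → ∃ x₁ : EuclideanSpace ℝ (Fin 3), x₁ 2 = 0 ∧ ∀ᵐ x ∂(MeasureTheory.volume : MeasureTheory.Measure (EuclideanSpace ℝ (Fin 3))), u (WithLp.toLp 2 ![Real.cos (2 * Real.pi / p) * x 0 - Real.sin (2 * Real.pi / p) * x 1, Real.sin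 (2 * Real.pi / p) * x 0 + Real.cos (2 * Real.pi / p) * x 1, x 2] - x₁) = WithLp.toLp 2 ![Real.cos (2 * Real.pi / p) * u x 0 - Real.sin (2 * Real.pi / p) * u x 1, Real.sin (2 * Real.pi / p) * u x 0 + Real.cos (2 * Real.pi / p) * u x 1, u x 2] := by
  intro p U lam x₀ u hU hsym hlam hu hne hconv
  -- the written-out rotation is `rotZ (2π/p)` definitionally
  have hsym' : ∀ j, ∀ᵐ x ∂(volume : Measure (EuclideanSpace ℝ (Fin 3))),
      U j (rotZ (2 * Real.pi / p) x) = rotZ (2 * Real.pi / p) (U j x) := hsym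
  -- the modulated fields are measurable
  have hv : ∀ j, AEStronglyMeasurable (rescaleData (lam j) (fun x => U j (x - x₀ j))) volume := by
    intro j
    have hS : Measure.QuasiMeasurePreserving (fun x : EuclideanSpace ℝ (Fin 3) => lam j • x - x₀ j) volume volume :=
      (measurePreserving_sub_right volume (x₀ j)).quasiMeasurePreserving.comp
        (Measure.quasiMeasurePreserving_smul volume (hlam j).ne')
    exact ((hU j).1.comp_quasiMeasurePreserving hS).const_smul (lam j)
  obtain ⟨x₁, hx₁, h⟩ := symmetryDefect_limit (θ := 2 * Real.pi / p)
    (v := fun j => rescaleData (lam j) (fun x => U j (x - x₀ j)))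
    (c := fun j => (lam j)⁻¹ • (x₀ j - rotZ (2 * Real.pi / p) (x₀ j))) hv
    (fun j => symmetryDefect_rescale_ae (hsym' j) (hlam j).ne' (x₀ j))
    (fun j => by simp) hu hne hconv
  exact ⟨x₁, hx₁, h⟩

end Summit.NavierStokesRegularity.NavierStokesRegularity.Theorems

end
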